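import Literature.AlgebraicGeometry.Motives.HodgeStructurePontryaginExponential
import HarnessLib

/-!
# Beauville's `SL₂` on `H•(X) = ⋀W`: `exp(−L) = e^{−θ} ∧ ·`, `exp(Λ) = · ⋆ e^{θ}`, and the Weyl element
# `w = exp(Λ) exp(−L) exp(Λ) = exp(−L) exp(Λ) exp(−L)`, i.e. `w x = e^{−θ} ∧ ((e^{−θ} ∧ x) ⋆ e^{θ})` — the Fourier side of `(0 −1 ; 1 0)`

[topic AlgebraicGeometry/Motives]

Layer `Literature/AlgebraicGeometry/Motives`, lane `lit-hodgefound` (Track 2 foundations library; prover seat `lit-hodgefound-p34`,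
generation 37, row g37-#2). THEOREMS ONLY (no definition, no named fact, no instance, no notation; net debt `0`). Sequel of rows
g31-#1/#3 (`Algebra/Lie/LefschetzModuleWeylOperator`: the Weyl operator `w = exp(f) exp(−e) exp(f)` of a Lefschetz module, `w e = −f w`,
`w f = −e w`, `w⁴ = 1`; `Motives/HodgeStructureExteriorAlgebraWeylOperator`: `weylStar ω g` on `⋀W`), g36-#8 (`Λ_ω x = x ⋆ ω^{[g−1]}`) and
g36-#12 (`HodgeStructurePontryaginExponential`: `x ⋆ e^ω = e^Λ x`, `Λ^{g+1} = 0`).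

THE POINT. Beauville (2010) makes `SL₂` act on the Chow ring (and on cohomology) of a polarized abelian variety `(A, θ)` through
correspondences: `u = (1 a ; 0 1) ↦ (z ↦ e^{aθ} z)`, `(1 0 ; a 1) ↦ (z ↦ d⁻¹ aᵍ e^{θ/a} ⋆ z)`, `w = (0 −1 ; 1 0) ↦ ℱ` (the Fourier transform),
with Lie algebra `X = θ ·`, `Y = d⁻¹ θ^{g−1}/(g−1)! ⋆ ·`, `H = (2p − g − s)`. On the carrier `H•(X) = ⋀W` of this lane (`ω` principal,
`d = 1`, `s = 0`), `X = L = ω ∧ ·` and, by row g36-#8, `Y = · ⋆ ω^{[g−1]} = Λ_ω` IS the tree's dual Lefschetz operator: Beauville's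
`𝔰𝔩₂` is the Lefschetz `𝔰𝔩₂` `(L, Λ, N − g)`. This file proves the EXPONENTIATED dictionary in the exterior algebra:
`exp(−L) = e^{−ω} ∧ ·` (§2), `exp(Λ) = · ⋆ e^{ω}` (§2, = row g36-#12), and, for the Weyl element `w = weylStar ω g` of the tree
(`= exp(Λ) exp(−L) exp(Λ) = image of (0 −1 ; 1 0) = exp(Y) exp(−X) exp(Y)`), the BRAID FORM `w = exp(−L) exp(Λ) exp(−L)` (§1, for any
Lefschetz module: `(0 −1 ; 1 0) = exp(−X) exp(Y) exp(−X)` too) — whence **BEAUVILLE'S FORMULA `w x = e^{−ω} ∧ ((e^{−ω} ∧ x) ⋆ e^{ω})`**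
(§3: the matrix identity `w = u⁻¹ v u⁻¹`, `v = (1 0 ; 1 1) = u w u` of Beauville's proof of Thm. 3.? read on `⋀W`), and Beauville's
Corollary "`ℱ(θ^q/q! z) = (−θ)^r/r! z` for `z` primitive, `q + r = g + s − 2p`" FOR `w` (§3, from row g31's string formula). The
identification of `w` with the cohomological Fourier transform `ℱ = (e^℘)_*`, `℘ = p^*θ + q^*θ − m^*θ`, is the next row.

## Sources, VERBATIM

A. Beauville, *The action of `SL₂` on abelian varieties*, J. Ramanujan Math. Soc. **25** (2010) 253–263, arXiv:0805.1541
[Beauville2010SL2] (held text `paper:arxiv-0805.1541`, arXiv version, unnumbered statements cited by section):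
§2 (p0003): "Recall that the group `SL₂(ℤ)` is generated by the elements `w = (0 −1 ; 1 0)`, `u = (1 1 ; 0 1)` with the relations
`w² = (uw)³`, `w⁴ = 1`." §3, proof of the Theorem (p0004): "To prove the fourth one, put `v = (1 0 ; 1 1)`; we have `v = uwu`. Thus […]
`φ(v) = Δ_* e^θ ∘ e^℘ ∘ Δ_* e^θ = e^{℘ + p^*θ + q^*θ}`. Since `℘ = p^*θ + q^*θ − m^*θ` and `m^*θ + δ^*θ = 2p^*θ + 2q^*θ` by the seesaw
theorem, this gives `φ(v) = e^{δ^*θ}`." §4 **Theorem** (p0005): "Let `A` be an abelian variety, with a polarization `θ` of degree `d`.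
There is a representation of `SL₂` on `CH(A)` […] such that, for `n ∈ ℤ ∖ {0}`, `a ∈ ℚ`, `z ∈ CH(A)`: `(n 0 ; 0 n⁻¹)·z = n^{−g} n^*z`,
`(0 −1 ; 1 0)·z = ℱ(z)`, `(1 a ; 0 1)·z = e^{aθ} z`, `(1 0 ; a 1)·z = d⁻¹ aᵍ e^{θ/a} ⋆ z`. The corresponding action of the Lie algebra
`𝔰𝔩₂` is given by: `Xz = θz`, `Yz = d⁻¹ (θ^{g−1}/(g−1)!) ⋆ z`, `Hz = (2p−g−s) z` for `z ∈ CH^p_s(A)`." and its proof: "`(e^{δ^*θ/a})_* z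
= q_*σ_*σ^*(e^{δ^*θ/a} · p^*z) = m_*(p^*e^{θ/a} · q^*z) = e^{θ/a} ⋆ z`". §5 (p0006): "We say that an element `z ∈ CH^p_s(A)` is
primitive if `θ^{g−1} ⋆ z = 0`. […] **Corollary** Let `z ∈ CH^p_s(A)` be a primitive element, and let `q ≤ g+s−2p`. Then
`ℱ(θ^q/q! z) = (−θ)^r/r! z`, with `r = g+s−2p−q`."
Y. André, *Pour une théorie inconditionnelle des motifs* (1996) [Andre1996Motifs], §1.2 (p. 11): "l'élément `(0 1 ; −1 0)` de `SL₂`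
s'envoie sur `± *_H`" (the tree's `weylStar`/`andreStar`). N. Bourbaki, *Groupes et algèbres de Lie* VIII §1 no. 5 (the element
`θ = e^X e^{−Y} e^X` of `SL(2)`) — background, not cited in statements.

## What is proved (all `theorem`s)

* §1 (any Lefschetz module `(M, h, e)`, `f = ᶜΛ`, `w = exp(f) exp(−e) exp(f)`): `weylOperator_mul_exp_dual` (`w exp(f) = exp(−e) w`),
  `weylOperator_mul_exp_neg` (`w exp(−e) = exp(f) w`), **`weylOperator_eq_exp_neg_mul_exp_dual_mul_exp_neg`: `w = exp(−e) exp(f) exp(−e)`**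
  (conjugate `w` by itself: `w = w w w⁻¹`, `w⁴ = 1`).
* §2 (`⋀W`, `ω` symplectic of genus `g`): `IsSymplectic.pow_genus_succ_eq_zero` (`ω^{g+1} = 0`), **`IsSymplectic.exp_neg_mul_eq`:
  `exp(−L) = e^{−ω} ∧ ·`**, `IsSymplectic.exp_mul_eq` (`exp(L) = e^{ω} ∧ ·`), **`IsSymplectic.exp_lefschetzDual_eq`: `exp(Λ) = Σ_{k≤g} Λ^k/k!`**,
  `IsSymplectic.exp_lefschetzDual_apply` (`exp(Λ) x = x ⋆ e^{ω}`, Beauville's `exp(Y) = e^θ ⋆`), with `e^{±ω} = Σ_{m≤g} (±ω)^m/m!`.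
* §3 **`IsSymplectic.weylStar_eq_mul_exp`** (`w = (e^{−ω} ∧ ·) ∘ (Σ_k Λ^k/k!) ∘ (e^{−ω} ∧ ·)` as operators on `⋀W`, `g ≥ 1`),
  **`IsSymplectic.weylStar_apply_eq_pontryagin`: `w x = e^{−ω} ∧ ((e^{−ω} ∧ x) ⋆ e^{ω})`** (BEAUVILLE'S FOURIER TRANSFORM FORMULA FOR THE
  WEYL ELEMENT), and **`IsSymplectic.weylStar_apply_inv_factorial_smul_pow_mul_of_mem_primitive`: `w(ω^q/q! ∧ p) = (−ω)^r/r! ∧ p`** for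
  `p ∈ Pᵏ`, `q + r = g − k` (Beauville's Corollary, `s = 0`).

TWIN NOTICE (RULING 29 bis): the torus-forms carrier has the cohomological Fourier transform of Lange §6.2–6.3
(`Geometry/Kaehler/ComplexTorusFourierCohomology`, `…FourierPontryagin`, `…BeauvilleFourierPolarization`, …) — BY NAME, nothing imported
or restated; the present file concerns the WEYL ELEMENT of the Lefschetz `𝔰𝔩₂` on the abstract carrier `⋀W`.

## References

* [Beauville2010SL2] A. Beauville, *The action of `SL₂` on abelian varieties*, J. Ramanujan Math. Soc. 25 (2010) 253–263, arXiv:0805.1541,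
  §2, §3 (Theorem and its proof), §4 (Theorem), §5 (Proposition, Corollaries).
* [Andre1996Motifs] Y. André, *Pour une théorie inconditionnelle des motifs*, Publ. Math. IHÉS 83 (1996), §1.2 (p. 11).
* [Lange2023AbelianVarietiesComplex] H. Lange, *Abelian Varieties over the Complex Numbers* (2023), §2.5.3 Thm. 2.5.16 (p0135).
* [LooijengaLunts1997] E. Looijenga, V. A. Lunts, *A Lie algebra attached to a projective variety*, Invent. Math. 129 (1997), §1 (1.1), §3 (3.3).
-/

noncomputable section

open scoped TensorProduct Nat

namespace Literature.AlgebraicGeometry.Motives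

/-! ## §1 The braid form of the Weyl operator of a Lefschetz module: `w = exp(f) exp(−e) exp(f) = exp(−e) exp(f) exp(−e)` -/

section LefschetzModule

open Literature.Algebra.Lie

variable {K : Type*} [Field K] [CharZero K] {M : Type*} [AddCommGroup M] [Module K M] [FiniteDimensional K M]
  {h e : Module.End K M}

omit [FiniteDimensional K M] in
/-- The finite exponential `exp a = Σ_{i<n} aⁱ/i!` of an operator with `aⁿ = 0`, with coefficients read in `K` (a copy of the private
lemma of `LefschetzModuleWeylOperator`). [folklore] -/
private theorem exp_eq_sum_of_pow_eq_zero' {a : Module.End K M} {n : ℕ} (ha : a ^ n = 0) :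
    letI := Algebra.compHom (Module.End K M) (algebraMap ℚ K)
    IsNilpotent.exp a = ∑ i ∈ Finset.range n, ((i ! : ℕ) : K)⁻¹ • a ^ i := by
  letI := Algebra.compHom (Module.End K M) (algebraMap ℚ K)
  rw [IsNilpotent.exp_eq_sum ha]
  refine Finset.sum_congr rfl fun i _ ↦ ?_
  rw [Algebra.compHom_smul_def, map_inv₀, map_natCast]

/-- **`w exp(f) = exp(−e) w`** (`w fⁿ = (−e)ⁿ w` from `w f = −e w`, summed). Declared into the namespace of
`Algebra/Lie/LefschetzModuleWeylOperator` as a dot-notation extension. [cite: Beauville2010SL2, §2 (relations of SL₂(ℤ)) and §4 Theorem]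
[cite: Andre1996Motifs, §1.2 (p. 11)] -/
theorem _root_.Literature.Algebra.Lie.HasLefschetzProperty.weylOperator_mul_exp_dual (L : HasLefschetzProperty h e) (hgr : IsZGrading h) :
    letI := Algebra.compHom (Module.End K M) (algebraMap ℚ K)
    L.weylOperator hgr * IsNilpotent.exp (L.dual hgr) = IsNilpotent.exp (-e) * L.weylOperator hgr := by
  letI := Algebra.compHom (Module.End K M) (algebraMap ℚ K)
  obtain ⟨k₁, hk₁⟩ := L.isNilpotent_dual hgr
  obtain ⟨k₂, hk₂⟩ := (L.isNilpotent_of_hasLefschetzProperty hgr).neg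
  have hf : L.dual hgr ^ (k₁ + k₂) = 0 := by rw [pow_add, hk₁, zero_mul]
  have he : (-e) ^ (k₁ + k₂) = 0 := by rw [pow_add, hk₂, mul_zero]
  have h1 : ∀ n : ℕ, L.weylOperator hgr * L.dual hgr ^ n = (-e) ^ n * L.weylOperator hgr := by
    intro n
    induction n with
    | zero => rw [pow_zero, pow_zero, mul_one, one_mul]
    | succ n ih =>
      rw [pow_succ, ← mul_assoc, ih, mul_assoc, L.weylOperator_mul_dual hgr, ← neg_mul, ← mul_assoc, ← pow_succ]
  rw [exp_eq_sum_of_pow_eq_zero' hf, exp_eq_sum_of_pow_eq_zero' he, Finset.mul_sum, Finset.sum_mul]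
  refine Finset.sum_congr rfl fun i _ ↦ ?_
  rw [mul_smul_comm, smul_mul_assoc, h1]

/-- **`w exp(−e) = exp(f) w`** (`w (−e)ⁿ = fⁿ w` from `w e = −f w`, summed). [cite: Beauville2010SL2, §2 and §4 Theorem]
[cite: Andre1996Motifs, §1.2 (p. 11)] -/
theorem _root_.Literature.Algebra.Lie.HasLefschetzProperty.weylOperator_mul_exp_neg (L : HasLefschetzProperty h e) (hgr : IsZGrading h) :
    letI := Algebra.compHom (Module.End K M) (algebraMap ℚ K)
    L.weylOperator hgr * IsNilpotent.exp (-e) = IsNilpotent.exp (L.dual hgr) * L.weylOperator hgr := by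
  letI := Algebra.compHom (Module.End K M) (algebraMap ℚ K)
  obtain ⟨k₁, hk₁⟩ := L.isNilpotent_dual hgr
  obtain ⟨k₂, hk₂⟩ := (L.isNilpotent_of_hasLefschetzProperty hgr).neg
  have hf : L.dual hgr ^ (k₁ + k₂) = 0 := by rw [pow_add, hk₁, zero_mul]
  have he : (-e) ^ (k₁ + k₂) = 0 := by rw [pow_add, hk₂, mul_zero]
  have h1 : ∀ n : ℕ, L.weylOperator hgr * (-e) ^ n = L.dual hgr ^ n * L.weylOperator hgr := by
    intro n
    induction n with
    | zero => rw [pow_zero, pow_zero, mul_one, one_mul]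
    | succ n ih =>
      rw [pow_succ, ← mul_assoc, ih, mul_assoc, mul_neg, L.weylOperator_mul_e hgr, neg_neg, ← mul_assoc, ← pow_succ]
  rw [exp_eq_sum_of_pow_eq_zero' hf, exp_eq_sum_of_pow_eq_zero' he, Finset.mul_sum, Finset.sum_mul]
  refine Finset.sum_congr rfl fun i _ ↦ ?_
  rw [mul_smul_comm, smul_mul_assoc, h1]

/-- **THE BRAID FORM OF THE WEYL OPERATOR: `w = exp(−e) exp(f) exp(−e)`** — in `SL₂`, `(0 −1 ; 1 0) = exp(Y) exp(−X) exp(Y) =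
exp(−X) exp(Y) exp(−X)` (`X ↦ e`, `Y ↦ f`); on a Lefschetz module the tree DEFINES `w = exp(f) exp(−e) exp(f)`, and conjugating this
product by `w` itself (`w exp(f) w⁻¹ = exp(−e)`, `w exp(−e) w⁻¹ = exp(f)`, `w⁴ = 1`) gives the other word.
[cite: Beauville2010SL2, §2 ("w² = (uw)³, w⁴ = 1") and §3 (proof of the Theorem: "v = uwu")] [cite: Andre1996Motifs, §1.2 (p. 11)] -/
theorem _root_.Literature.Algebra.Lie.HasLefschetzProperty.weylOperator_eq_exp_neg_mul_exp_dual_mul_exp_neg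
    (L : HasLefschetzProperty h e) (hgr : IsZGrading h) :
    letI := Algebra.compHom (Module.End K M) (algebraMap ℚ K)
    L.weylOperator hgr = IsNilpotent.exp (-e) * IsNilpotent.exp (L.dual hgr) * IsNilpotent.exp (-e) := by
  letI := Algebra.compHom (Module.End K M) (algebraMap ℚ K)
  set w := L.weylOperator hgr with hw
  set E := IsNilpotent.exp (-e) with hE
  set F := IsNilpotent.exp (L.dual hgr) with hF
  have hA : w * F = E * w := L.weylOperator_mul_exp_dual hgr
  have hB : w * E = F * w := L.weylOperator_mul_exp_neg hgr
  -- `w w = (E F E) w`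
  have hdef : w = F * E * F := L.weylOperator_def hgr
  have hww : w * w = E * F * E * w := by
    calc w * w = w * (F * E * F) := by rw [← hdef]
      _ = (w * F) * E * F := by rw [mul_assoc, mul_assoc, mul_assoc]
      _ = E * (w * E) * F := by rw [hA, mul_assoc E w E]
      _ = E * F * (w * F) := by rw [hB, ← mul_assoc, mul_assoc (E * F) w F]
      _ = E * F * E * w := by rw [hA, ← mul_assoc]
  -- cancel `w` with `w⁴ = 1`
  have h4 : w * (w * (w * w)) = 1 := by
    have := L.weylOperator_pow_four hgr
    rw [← hw] at this
    calc w * (w * (w * w)) = w ^ 4 := by noncomm_ring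
      _ = 1 := this
  calc w = w * (w * (w * (w * w))) := by rw [h4, mul_one]
    _ = (w * w) * (w * (w * w)) := by rw [mul_assoc]
    _ = E * F * E * (w * (w * (w * w))) := by rw [hww, mul_assoc (E * F * E) w]
    _ = E * F * E := by rw [h4, mul_one]

end LefschetzModule

/-! ## §2 On `⋀W`: `exp(±L) = e^{±ω} ∧ ·` and `exp(Λ) = Σ_{k≤g} Λ^k/k! = · ⋆ e^{ω}` -/

namespace ExteriorLefschetz

open ExteriorAlgebra Literature.Algebra.Lie

variable {K : Type*} [Field K] [CharZero K] {W : Type*} [AddCommGroup W] [Module K W] {ω : ExteriorAlgebra K W} {g : ℕ}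

omit [CharZero K] in
/-- `ω^{g+1} = 0` for a symplectic 2-vector of genus `g` (`ω^{g+1} ∈ ⋀^{2g+2} W = 0`, `dim W = 2g`).
[cite: Lange2023AbelianVarietiesComplex, §2.5.3 Thm. 2.5.16 (p0135)] [cite: BourbakiAlgebre1a3, Ch. III §7 no. 3 Prop. 6] -/
theorem IsSymplectic.pow_genus_succ_eq_zero (hω : IsSymplectic ω g) : ω ^ (g + 1) = 0 := by
  have hmem := pow_mem_exteriorPower hω.mem (g + 1)
  rwa [hω.exteriorPower_eq_bot (by omega), Submodule.mem_bot] at hmem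

/-- **`exp(e_η) = e^{η} ∧ ·` for `ηⁿ = 0`**: the exponential of the (nilpotent) multiplication operator `e_η = η ∧ ·` on `⋀W` is
multiplication by the finite exponential `e^{η} = Σ_{m<n} η^m/m!` — Beauville's `(1 a ; 0 1)·z = e^{aθ} z`, `exp(aX) = e^{aθ} ·`.
[cite: Beauville2010SL2, §4 Theorem ("(1 a ; 0 1)·z = e^{aθ}z", "Xz = θz")] -/
theorem exp_mul_eq_of_pow_eq_zero {η : ExteriorAlgebra K W} {n : ℕ} (hη : η ^ n = 0) :
    letI := Algebra.compHom (Module.End K (ExteriorAlgebra K W)) (algebraMap ℚ K)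
    IsNilpotent.exp (LinearMap.mul K (ExteriorAlgebra K W) η) =
      LinearMap.mul K (ExteriorAlgebra K W) (∑ m ∈ Finset.range n, (m ! : K)⁻¹ • η ^ m) := by
  letI := Algebra.compHom (Module.End K (ExteriorAlgebra K W)) (algebraMap ℚ K)
  have hn : LinearMap.mul K (ExteriorAlgebra K W) η ^ n = 0 := by rw [mul_pow_eq_mul_pow, hη, map_zero]
  rw [IsNilpotent.exp_eq_sum hn, map_sum]
  refine Finset.sum_congr rfl fun i _ ↦ ?_
  rw [Algebra.compHom_smul_def, map_inv₀, map_natCast, map_smul, mul_pow_eq_mul_pow]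

/-- **`exp(−L) = e^{−ω} ∧ ·`** (Beauville's `u⁻¹ = (1 −1 ; 0 1) ↦ e^{−θ} ·`), `e^{−ω} = Σ_{m≤g} (−ω)^m/m!`. [cite: Beauville2010SL2, §4 Theorem] -/
theorem IsSymplectic.exp_neg_mul_eq (hω : IsSymplectic ω g) :
    letI := Algebra.compHom (Module.End K (ExteriorAlgebra K W)) (algebraMap ℚ K)
    IsNilpotent.exp (-LinearMap.mul K (ExteriorAlgebra K W) ω) =
      LinearMap.mul K (ExteriorAlgebra K W) (∑ m ∈ Finset.range (g + 1), (m ! : K)⁻¹ • (-ω) ^ m) := by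
  letI := Algebra.compHom (Module.End K (ExteriorAlgebra K W)) (algebraMap ℚ K)
  have h0 : (-ω) ^ (g + 1) = 0 := by rw [neg_pow, hω.pow_genus_succ_eq_zero, mul_zero]
  rw [← map_neg]
  exact exp_mul_eq_of_pow_eq_zero h0

/-- **`exp(L) = e^{ω} ∧ ·`** (Beauville's `u = (1 1 ; 0 1) ↦ e^{θ} ·`), `e^{ω} = Σ_{m≤g} ω^m/m!`. [cite: Beauville2010SL2, §4 Theorem] -/
theorem IsSymplectic.exp_mul_eq (hω : IsSymplectic ω g) :
    letI := Algebra.compHom (Module.End K (ExteriorAlgebra K W)) (algebraMap ℚ K)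
    IsNilpotent.exp (LinearMap.mul K (ExteriorAlgebra K W) ω) =
      LinearMap.mul K (ExteriorAlgebra K W) (∑ m ∈ Finset.range (g + 1), (m ! : K)⁻¹ • ω ^ m) :=
  exp_mul_eq_of_pow_eq_zero hω.pow_genus_succ_eq_zero

/-- **`exp(Λ) = Σ_{k≤g} Λ^k/k!`** (`Λ^{g+1} = 0`, row g36-#12). [cite: Beauville2010SL2, §4 Theorem ("Yz = θ^{g−1}/(g−1)! ⋆ z")]
[cite: Huybrechts2005, Prop. 1.2.30] -/
theorem IsSymplectic.exp_lefschetzDual_eq (hω : IsSymplectic ω g) :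
    letI := Algebra.compHom (Module.End K (ExteriorAlgebra K W)) (algebraMap ℚ K)
    IsNilpotent.exp (lefschetzDual ω g) = ∑ k ∈ Finset.range (g + 1), (k ! : K)⁻¹ • lefschetzDual ω g ^ k := by
  letI := Algebra.compHom (Module.End K (ExteriorAlgebra K W)) (algebraMap ℚ K)
  rw [IsNilpotent.exp_eq_sum hω.lefschetzDual_pow_genus_succ]
  refine Finset.sum_congr rfl fun i _ ↦ ?_
  rw [Algebra.compHom_smul_def, map_inv₀, map_natCast]

/-- **`exp(Λ) x = x ⋆ e^{ω}`** — Beauville's `(1 0 ; 1 1)·z = e^{θ} ⋆ z`, `exp(Y) = e^θ ⋆` (principal case), the exponentiated form of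
row g36-#12 `x ⋆ e^ω = e^Λ x`. [cite: Beauville2010SL2, §4 Theorem ("(1 0 ; a 1)·z = d⁻¹aᵍe^{θ/a} ⋆ z")]
[cite: Lange2023AbelianVarietiesComplex, §2.5.3 Thm. 2.5.16 (p0135)] -/
theorem IsSymplectic.exp_lefschetzDual_apply (hω : IsSymplectic ω g) (x : ExteriorAlgebra K W) :
    letI := Algebra.compHom (Module.End K (ExteriorAlgebra K W)) (algebraMap ℚ K)
    IsNilpotent.exp (lefschetzDual ω g) x = hω.pontryagin x (∑ m ∈ Finset.range (g + 1), (m ! : K)⁻¹ • ω ^ m) := by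
  letI := Algebra.compHom (Module.End K (ExteriorAlgebra K W)) (algebraMap ℚ K)
  rw [hω.exp_lefschetzDual_eq, hω.pontryagin_sum_inv_factorial_smul_pow, LinearMap.sum_apply]
  exact Finset.sum_congr rfl fun k _ ↦ by rw [LinearMap.smul_apply]

/-! ## §3 Beauville's formula for the Weyl element: `w x = e^{−ω} ∧ ((e^{−ω} ∧ x) ⋆ e^{ω})` -/

/-- **`w = (e^{−ω} ∧ ·) ∘ (Σ_{k≤g} Λ^k/k!) ∘ (e^{−ω} ∧ ·)` ON `⋀W`** (`g ≥ 1`): the Weyl element `weylStar ω g = exp(Λ) exp(−L) exp(Λ)` in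
its braid form `exp(−L) exp(Λ) exp(−L)` (§1), with `exp(−L) = e^{−ω} ∧ ·` and `exp(Λ) = Σ_k Λ^k/k!` (§2) — Beauville's
`w = u⁻¹ v u⁻¹`, `u⁻¹ ↦ e^{−θ}·`, `v ↦ exp(Y)`. [cite: Beauville2010SL2, §3 (proof of the Theorem, "v = uwu") and §4 Theorem]
[cite: Andre1996Motifs, §1.2 (p. 11)] -/
theorem IsSymplectic.weylStar_eq_mul_exp (hω : IsSymplectic ω g) (hg : 0 < g) :
    weylStar ω g = LinearMap.mul K (ExteriorAlgebra K W) (∑ m ∈ Finset.range (g + 1), (m ! : K)⁻¹ • (-ω) ^ m) *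
      (∑ k ∈ Finset.range (g + 1), (k ! : K)⁻¹ • lefschetzDual ω g ^ k) *
        LinearMap.mul K (ExteriorAlgebra K W) (∑ m ∈ Finset.range (g + 1), (m ! : K)⁻¹ • (-ω) ^ m) := by
  letI := Algebra.compHom (Module.End K (ExteriorAlgebra K W)) (algebraMap ℚ K)
  haveI := hω.finiteDimensional_exteriorAlgebra
  rw [hω.weylStar_eq, (hω.hasLefschetzProperty_mul).weylOperator_eq_exp_neg_mul_exp_dual_mul_exp_neg, hω.dual_eq_lefschetzDual hg,
    hω.exp_neg_mul_eq, hω.exp_lefschetzDual_eq]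

/-- **BEAUVILLE'S FORMULA FOR THE WEYL ELEMENT: `w x = e^{−ω} ∧ ((e^{−ω} ∧ x) ⋆ e^{ω})`** (`g ≥ 1`; `e^{±ω} = Σ_{m≤g} (±ω)^m/m!`) —
the image of `(0 −1 ; 1 0) = u⁻¹ v u⁻¹` acts as `z ↦ e^{−θ}·(e^{θ} ⋆ (e^{−θ}·z))`, where Beauville's Theorem identifies `(0 −1 ; 1 0)` with
the Fourier transform `ℱ`; here stated for the tree's Weyl element `weylStar ω g` of the Lefschetz `𝔰𝔩₂` (the identification
`ℱ = (e^℘)_* = w` on this carrier is the next row). [cite: Beauville2010SL2, §4 Theorem and §3 (proof of the Theorem)]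
[cite: Lange2023AbelianVarietiesComplex, §2.5.3 Thm. 2.5.16 (p0135)] -/
theorem IsSymplectic.weylStar_apply_eq_pontryagin (hω : IsSymplectic ω g) (hg : 0 < g) (x : ExteriorAlgebra K W) :
    weylStar ω g x = (∑ m ∈ Finset.range (g + 1), (m ! : K)⁻¹ • (-ω) ^ m) *
      hω.pontryagin ((∑ m ∈ Finset.range (g + 1), (m ! : K)⁻¹ • (-ω) ^ m) * x)
        (∑ m ∈ Finset.range (g + 1), (m ! : K)⁻¹ • ω ^ m) := by
  rw [hω.weylStar_eq_mul_exp hg, Module.End.mul_apply, Module.End.mul_apply, LinearMap.mul_apply', LinearMap.mul_apply',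
    hω.pontryagin_sum_inv_factorial_smul_pow, LinearMap.sum_apply]
  simp only [LinearMap.smul_apply]

/-- **BEAUVILLE'S COROLLARY FOR THE WEYL ELEMENT: `w(ω^q/q! ∧ p) = (−ω)^r/r! ∧ p`** for a primitive `p ∈ Pᵏ` (`k ≤ g`) and
`q + r = g − k` ("`ℱ(θ^q/q! z) = (−θ)^r/r! z` with `r = g + s − 2p − q`", `s = 0`, `2p = k`): the string formula
`w(ωʳ ∧ p) = (−1)^{g−k+r} (r!/(g−k−r)!) ω^{g−k−r} ∧ p` of row g31-#1 in Beauville's divided-power normalization.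
[cite: Beauville2010SL2, §5 Corollary ("ℱ(θ^q/q! z) = (−θ)^r/r! z")] [cite: Andre1996Motifs, §1.2 (p. 11)] -/
theorem IsSymplectic.weylStar_apply_inv_factorial_smul_pow_mul_of_mem_primitive (hω : IsSymplectic ω g) {k : ℕ} (hk : k ≤ g)
    {p : ExteriorAlgebra K W} (hp : p ∈ primitive ω g k) {q r : ℕ} (hqr : q + r = g - k) :
    weylStar ω g ((q ! : K)⁻¹ • (ω ^ q * p)) = (r ! : K)⁻¹ • ((-ω) ^ r * p) := by
  have hq : (q ! : K) ≠ 0 := by exact_mod_cast Nat.factorial_ne_zero q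
  have hneg : (-ω) ^ r = ((-1 : K) ^ r) • ω ^ r := by rw [← smul_pow, neg_one_smul]
  rw [map_smul, hω.weylStar_apply_pow_mul_of_mem_primitive hk hp (by omega : q ≤ g - k), smul_smul, show g - k - q = r by omega,
    hneg, smul_mul_assoc, smul_smul]
  congr 1
  rw [show g - k + q = r + 2 * q by omega, pow_add, pow_mul, neg_one_sq, one_pow, mul_one]
  calc (q ! : K)⁻¹ * ((-1 : K) ^ r * (q ! : K) * (r ! : K)⁻¹) = (-1 : K) ^ r * (r ! : K)⁻¹ * ((q ! : K)⁻¹ * (q ! : K)) := by ring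
    _ = (r ! : K)⁻¹ * (-1 : K) ^ r := by rw [inv_mul_cancel₀ hq, mul_one, mul_comm]

end ExteriorLefschetz

end Literature.AlgebraicGeometry.Motives
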